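import Summits.HodgeConjecture.HodgeConjecture.Theorems.Ring2WeilCoverageWeilGramLevel28SqrtNegSeven
import Summits.HodgeConjecture.HodgeConjecture.Theorems.Ring2WeilCoverageRamifiedTypesLevels21and28
import HarnessLib

/-!
# Weil-type family coverage — THE COMPONENTS OF THE WEIL-TYPE `ℤ[ζ₂₈]`-SIXFOLDS, IV: the RAMIFIED type `𝔮₇`
# (`π₇ = ζ²⁵(1 − ζ⁴)(1 − ζ²)`, `(𝔬𝔣₀)⁶ = (7)`, degree `7`) against `√−7`: Gram determinant `−153664 = −392²` — RIGHT
# sign, SPLIT: the type-`𝔮₇` polarised Weil-type `ℤ[ζ₂₈]`-sixfolds lie on row R0 for `ℚ(√−7)` (census W6.7.1)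

research route conditional on HC_CM; not a corollary; Q11.4-sentence-2 already refuted in dim ≥ 3.

Ring 2, WEIL-TYPE FAMILY-COVERAGE CENSUS (`HOME/WEIL-FAMILY-COVERAGE.md` `## b01`, block b01.41 (B)/(C): «`(28, √−7)`:
type `𝔮₇`, degree `7 ≡ 1`: SPLIT», S-pencil there), part 107 of the `Ring2WeilCoverage*` series; continues parts
104–106.  Part 49a proved that EVERY `ℚ(√−7)`-balanced CM type `Φ` of `ℚ(ζ₂₈)` carries a `Φ`-positive divisor of type
`𝔣₀`, `𝔬𝔣₀ = (π₇)`.  Here: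

* §1 the eleven traces and **`det a(π₇ξ) = −153664 = −392²`** (`= N(π₇)·21952 = (−7)·21952`).
* §2 invariance over the type (THEOREM L (i) at `28`); CENSUS FORM; class **`[−153664] = splitDiscriminantClass 3 7`**:
  **the type-`𝔮₇` polarised Weil-type `ℤ[ζ₂₈]`-CM sixfolds — on EVERY `ℚ(√−7)`-balanced `Φ` — lie on the SPLIT
  component**, row R0 for `ℚ(√−7)` (census W6.7.1).

HONEST FRAMING as parts 104–106; `HC_CM` is used nowhere.  No `def`, no named fact, no `sorry`.  Certificates from
`work/py/gen6.py` + `lev28.py`, re-verified by `linear_combination`.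

References: [cite: vanGeemen1994HodgeAV, Lemma 5.2 (2)–(4), 5.4 and (5.4.1)]; [cite: Shimura1998, §14.3 Prop. 4–5,
pp. 103–104]; census b01.41 (B)/(C) (seat-derived).
-/

noncomputable section

open Polynomial NumberField Module
open scoped nonZeroDivisors

namespace Summit.HodgeConjecture.Ring2WeilCoverage.WeilGramLevel28TypeSeven

open Literature.AlgebraicGeometry.VanGeemen1994 (weilField weilNormResidueGroup)
open Literature.AlgebraicGeometry.Motives (CMType normUnitsSubgroup)
open Literature.NumberTheory.ComplexMultiplication
open Summit.HodgeConjecture.Ring2WeilCoverage.TraceGramDeterminant (trace_aeval_zeta_mul_inv)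
open Summit.HodgeConjecture.Ring2WeilCoverage.WeilGramCMPoint
open Summit.HodgeConjecture.Ring2WeilCoverage.RealUnitNormHalfSystems (complexConj_eq_inv)
open Summit.HodgeConjecture.Ring2WeilCoverage.CyclotomicPrincipalObstruction (complexConj_xi)
open Summit.HodgeConjecture.Ring2WeilCoverage.CyclotomicDifferent (isOfType_one_xi_top xi_ne_zero)
open Summit.HodgeConjecture.HodgeConjecture.Ring2.WeilCoverage (mk_neg_eq_split_of_odd mk_neg_ne_split_of_odd
  mem_normUnitsSubgroup_of_sq_add_mul_sq)
open Summit.HodgeConjecture.HodgeConjecture.Ring2.Hypotheses (splitDiscriminantClass)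
open Summit.HodgeConjecture.Ring2WeilCoverage.WeilGramLevel28
open Summit.HodgeConjecture.Ring2WeilCoverage.WeilGramLevel28Principal
open Summit.HodgeConjecture.Ring2WeilCoverage.WeilGramLevel28SqrtNegSeven
open Summit.HodgeConjecture.Ring2WeilCoverage.CyclotomicUnconditional (norm_realUnits_pos_twentyEight)
open Summit.HodgeConjecture.Ring2WeilCoverage.RamifiedTypes (isOfType_one_gen_mul_xi complexConj_gen_mul_xi gen_ne_zero)
open Summit.HodgeConjecture.Ring2WeilCoverage.RamifiedTypesLevels21and28 (adm_twentyEight exists_type_twentyEight_sqrt_neg_seven)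
variable {K : Type} [Field K] [NumberField K] {ζ : K}

/-- `𝐞(t) = exp(2πi t/n) ∈ ℂ` (`ZMod.toCircle`). -/
local notation3 (prettyPrint := false) "𝐞 " t:max => ((ZMod.toCircle t : Circle) : ℂ)

/-- the residue set `S_Φ` read at level `28`. -/
local notation3 (prettyPrint := false) "SΦ[" Φ "," z "]" =>
  (Finset.univ.filter fun t : ZMod 28 => ∃ σ ∈ (Φ : CMType K).1, σ (z : K) = 𝐞 t)

/-! ### §1 Type `𝔮₇`: `ζ′ = π₇ξ` — eleven traces, `det a = −153664` -/

/-- `Tr(ζ′sθ^0) = 0` for `ζ′ = π₇ξ, π₇ = ζ²⁵(1 − ζ⁴)(1 − ζ²)`, `s = √−7 = 1 + 2(ζ⁴ + ζ⁸ + ζ¹⁶)`, `θ = ζ + ζ⁻¹` (Euler evaluation). research route conditional on HC_CM; not a corollary; Q11.4-sentence-2 already refuted in dim ≥ 3. [folklore] -/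
theorem trace_piSeven_sqrtNegSeven_zero [IsCyclotomicExtension {28} ℚ K] (hζ : IsPrimitiveRoot ζ 28) :
    Algebra.trace ℚ K ((ζ ^ 25 * (1 - ζ ^ 4) * (1 - ζ ^ 2) * (ζ ^ 5 * (aeval ζ (derivative (cyclotomic 28 ℚ)))⁻¹)) * (1 + 2 * (ζ ^ 4 + ζ ^ 8 + ζ ^ 16))) = 0 := by
  have h28 : ζ ^ 28 = 1 := hζ.pow_eq_one
  have hΦ := cyc_twentyEight hζ
  rw [trace_of_key₀ hζ (C (2 : ℚ) + C (0 : ℚ) * X + C (-1 : ℚ) * X ^ 2 + C (0 : ℚ) * X ^ 3 + C (-3 : ℚ) * X ^ 4 +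
      C (0 : ℚ) * X ^ 5 + C (3 : ℚ) * X ^ 6 + C (0 : ℚ) * X ^ 7 + C (1 : ℚ) * X ^ 8 + C (0 : ℚ) * X ^ 9 +
      C (-2 : ℚ) * X ^ 10 + C (0 : ℚ) * X ^ 11) (by compute_degree) (by
    simp only [map_add, map_mul, map_pow, aeval_C, aeval_X, eq_ratCast]
    push_cast
    linear_combination ((aeval ζ (derivative (cyclotomic 28 ℚ)))⁻¹ * (-2 + 4 * ζ^4 - 4 * ζ^8 + 2 * ζ^12)) * hΦ +
      ((aeval ζ (derivative (cyclotomic 28 ℚ)))⁻¹ * (ζ^2 - ζ^4 + ζ^6 - ζ^8 - 2 * ζ^14 + 2 * ζ^16 + 2 * ζ^18 - 2 * ζ^20 -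
        2 * ζ^22 + 2 * ζ^24)) * h28)]
  norm_num [coeff_X_pow, coeff_X, coeff_C, coeff_one]

/-- `Tr(ζ′sθ^1) = -4` for `ζ′ = π₇ξ, π₇ = ζ²⁵(1 − ζ⁴)(1 − ζ²)`, `s = √−7 = 1 + 2(ζ⁴ + ζ⁸ + ζ¹⁶)`, `θ = ζ + ζ⁻¹` (Euler evaluation). research route conditional on HC_CM; not a corollary; Q11.4-sentence-2 already refuted in dim ≥ 3. [folklore] -/
theorem trace_piSeven_sqrtNegSeven_one [IsCyclotomicExtension {28} ℚ K] (hζ : IsPrimitiveRoot ζ 28) :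
    Algebra.trace ℚ K ((ζ ^ 25 * (1 - ζ ^ 4) * (1 - ζ ^ 2) * (ζ ^ 5 * (aeval ζ (derivative (cyclotomic 28 ℚ)))⁻¹)) * (1 + 2 * (ζ ^ 4 + ζ ^ 8 + ζ ^ 16)) * (ζ + ζ⁻¹)) = -4 := by
  have h28 : ζ ^ 28 = 1 := hζ.pow_eq_one
  have hΦ := cyc_twentyEight hζ
  rw [trace_of_key₁ hζ (C (0 : ℚ) + C (3 : ℚ) * X + C (0 : ℚ) * X ^ 2 + C (-6 : ℚ) * X ^ 3 + C (0 : ℚ) * X ^ 4 + C (2 : ℚ) * X ^ 5 +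
      C (0 : ℚ) * X ^ 6 + C (2 : ℚ) * X ^ 7 + C (0 : ℚ) * X ^ 8 + C (1 : ℚ) * X ^ 9 + C (0 : ℚ) * X ^ 10 +
      C (-4 : ℚ) * X ^ 11) (by compute_degree) (by
    simp only [map_add, map_mul, map_pow, aeval_C, aeval_X, eq_ratCast]
    push_cast
    linear_combination ((aeval ζ (derivative (cyclotomic 28 ℚ)))⁻¹ * (-2 * ζ^2 + 4 * ζ^4 + 4 * ζ^6 - 4 * ζ^8 - 4 * ζ^10 + 2 * ζ^12 + 2 * ζ^14)) * hΦ +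
      ((aeval ζ (derivative (cyclotomic 28 ℚ)))⁻¹ * (ζ^2 - ζ^10 - 2 * ζ^14 + 4 * ζ^18 - 4 * ζ^22 + 2 * ζ^26)) * h28)]
  norm_num [coeff_X_pow, coeff_X, coeff_C, coeff_one]

/-- `Tr(ζ′sθ^2) = 0` for `ζ′ = π₇ξ, π₇ = ζ²⁵(1 − ζ⁴)(1 − ζ²)`, `s = √−7 = 1 + 2(ζ⁴ + ζ⁸ + ζ¹⁶)`, `θ = ζ + ζ⁻¹` (Euler evaluation). research route conditional on HC_CM; not a corollary; Q11.4-sentence-2 already refuted in dim ≥ 3. [folklore] -/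
theorem trace_piSeven_sqrtNegSeven_two [IsCyclotomicExtension {28} ℚ K] (hζ : IsPrimitiveRoot ζ 28) :
    Algebra.trace ℚ K ((ζ ^ 25 * (1 - ζ ^ 4) * (1 - ζ ^ 2) * (ζ ^ 5 * (aeval ζ (derivative (cyclotomic 28 ℚ)))⁻¹)) * (1 + 2 * (ζ ^ 4 + ζ ^ 8 + ζ ^ 16)) * (ζ + ζ⁻¹) ^ 2) = 0 := by
  have h28 : ζ ^ 28 = 1 := hζ.pow_eq_one
  have hΦ := cyc_twentyEight hζ
  rw [trace_of_key hζ (C (7 : ℚ) + C (0 : ℚ) * X + C (-7 : ℚ) * X ^ 2 + C (0 : ℚ) * X ^ 3 + C (0 : ℚ) * X ^ 4 + C (0 : ℚ) * X ^ 5 +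
      C (0 : ℚ) * X ^ 6 + C (0 : ℚ) * X ^ 7 + C (7 : ℚ) * X ^ 8 + C (0 : ℚ) * X ^ 9 + C (-7 : ℚ) * X ^ 10 +
      C (0 : ℚ) * X ^ 11) (by compute_degree) (by
    simp only [map_add, map_mul, map_pow, aeval_C, aeval_X, eq_ratCast]
    push_cast
    linear_combination ((aeval ζ (derivative (cyclotomic 28 ℚ)))⁻¹ * (2 - 4 * ζ^2 + 2 * ζ^4 + 8 * ζ^6 - 8 * ζ^10 - 2 * ζ^12 + 2 * ζ^14)) * hΦ +
      ((aeval ζ (derivative (cyclotomic 28 ℚ)))⁻¹ * (2 + ζ^2 + ζ^4 - ζ^10 - ζ^12 - 2 * ζ^14 - 2 * ζ^16 + 4 * ζ^18 + 4 * ζ^20 -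
        4 * ζ^22 - 4 * ζ^24 + 2 * ζ^26 + 2 * ζ^28)) * h28)]
  norm_num [coeff_X_pow, coeff_X, coeff_C, coeff_one]

/-- `Tr(ζ′sθ^3) = -14` for `ζ′ = π₇ξ, π₇ = ζ²⁵(1 − ζ⁴)(1 − ζ²)`, `s = √−7 = 1 + 2(ζ⁴ + ζ⁸ + ζ¹⁶)`, `θ = ζ + ζ⁻¹` (Euler evaluation). research route conditional on HC_CM; not a corollary; Q11.4-sentence-2 already refuted in dim ≥ 3. [folklore] -/
theorem trace_piSeven_sqrtNegSeven_three [IsCyclotomicExtension {28} ℚ K] (hζ : IsPrimitiveRoot ζ 28) :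
    Algebra.trace ℚ K ((ζ ^ 25 * (1 - ζ ^ 4) * (1 - ζ ^ 2) * (ζ ^ 5 * (aeval ζ (derivative (cyclotomic 28 ℚ)))⁻¹)) * (1 + 2 * (ζ ^ 4 + ζ ^ 8 + ζ ^ 16)) * (ζ + ζ⁻¹) ^ 3) = -14 := by
  have h28 : ζ ^ 28 = 1 := hζ.pow_eq_one
  have hΦ := cyc_twentyEight hζ
  rw [trace_of_key hζ (C (0 : ℚ) + C (7 : ℚ) * X + C (0 : ℚ) * X ^ 2 + C (-14 : ℚ) * X ^ 3 + C (0 : ℚ) * X ^ 4 +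
      C (7 : ℚ) * X ^ 5 + C (0 : ℚ) * X ^ 6 + C (0 : ℚ) * X ^ 7 + C (0 : ℚ) * X ^ 8 + C (7 : ℚ) * X ^ 9 +
      C (0 : ℚ) * X ^ 10 + C (-14 : ℚ) * X ^ 11) (by compute_degree) (by
    simp only [map_add, map_mul, map_pow, aeval_C, aeval_X, eq_ratCast]
    push_cast
    linear_combination ((aeval ζ (derivative (cyclotomic 28 ℚ)))⁻¹ * (4 + 7 * ζ^2 - 2 * ζ^4 + 10 * ζ^6 + 8 * ζ^8 - 8 * ζ^10 - 10 * ζ^12 -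
        2 * ζ^14)) * hΦ +
      ((aeval ζ (derivative (cyclotomic 28 ℚ)))⁻¹ * (4 + 3 * ζ^2 + 2 * ζ^4 + ζ^6 - ζ^10 - 2 * ζ^12 - 3 * ζ^14 - 4 * ζ^16 +
        2 * ζ^18 + 8 * ζ^20 - 8 * ζ^24 - 2 * ζ^26 + 4 * ζ^28 + 2 * ζ^30)) * h28)]
  norm_num [coeff_X_pow, coeff_X, coeff_C, coeff_one]

/-- `Tr(ζ′sθ^4) = 0` for `ζ′ = π₇ξ, π₇ = ζ²⁵(1 − ζ⁴)(1 − ζ²)`, `s = √−7 = 1 + 2(ζ⁴ + ζ⁸ + ζ¹⁶)`, `θ = ζ + ζ⁻¹` (Euler evaluation). research route conditional on HC_CM; not a corollary; Q11.4-sentence-2 already refuted in dim ≥ 3. [folklore] -/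
theorem trace_piSeven_sqrtNegSeven_four [IsCyclotomicExtension {28} ℚ K] (hζ : IsPrimitiveRoot ζ 28) :
    Algebra.trace ℚ K ((ζ ^ 25 * (1 - ζ ^ 4) * (1 - ζ ^ 2) * (ζ ^ 5 * (aeval ζ (derivative (cyclotomic 28 ℚ)))⁻¹)) * (1 + 2 * (ζ ^ 4 + ζ ^ 8 + ζ ^ 16)) * (ζ + ζ⁻¹) ^ 4) = 0 := by
  have h28 : ζ ^ 28 = 1 := hζ.pow_eq_one
  have hΦ := cyc_twentyEight hζ
  rw [trace_of_key hζ (C (21 : ℚ) + C (0 : ℚ) * X + C (-21 : ℚ) * X ^ 2 + C (0 : ℚ) * X ^ 3 + C (7 : ℚ) * X ^ 4 +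
      C (0 : ℚ) * X ^ 5 + C (-7 : ℚ) * X ^ 6 + C (0 : ℚ) * X ^ 7 + C (21 : ℚ) * X ^ 8 + C (0 : ℚ) * X ^ 9 +
      C (-21 : ℚ) * X ^ 10 + C (0 : ℚ) * X ^ 11) (by compute_degree) (by
    simp only [map_add, map_mul, map_pow, aeval_C, aeval_X, eq_ratCast]
    push_cast
    linear_combination ((aeval ζ (derivative (cyclotomic 28 ℚ)))⁻¹ * (2 + 9 * ζ^2 - 9 * ζ^4 + 8 * ζ^6 + 18 * ζ^8 - 18 * ζ^12 - 10 * ζ^14)) * hΦ +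
      ((aeval ζ (derivative (cyclotomic 28 ℚ)))⁻¹ * (2 + 7 * ζ^2 + 5 * ζ^4 + 3 * ζ^6 + ζ^8 - ζ^10 - 3 * ζ^12 - 5 * ζ^14 -
        7 * ζ^16 - 2 * ζ^18 + 10 * ζ^20 + 8 * ζ^22 - 8 * ζ^24 - 10 * ζ^26 +
        2 * ζ^28 + 6 * ζ^30 + 2 * ζ^32)) * h28)]
  norm_num [coeff_X_pow, coeff_X, coeff_C, coeff_one]

/-- `Tr(ζ′sθ^5) = -42` for `ζ′ = π₇ξ, π₇ = ζ²⁵(1 − ζ⁴)(1 − ζ²)`, `s = √−7 = 1 + 2(ζ⁴ + ζ⁸ + ζ¹⁶)`, `θ = ζ + ζ⁻¹` (Euler evaluation). research route conditional on HC_CM; not a corollary; Q11.4-sentence-2 already refuted in dim ≥ 3. [folklore] -/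
theorem trace_piSeven_sqrtNegSeven_five [IsCyclotomicExtension {28} ℚ K] (hζ : IsPrimitiveRoot ζ 28) :
    Algebra.trace ℚ K ((ζ ^ 25 * (1 - ζ ^ 4) * (1 - ζ ^ 2) * (ζ ^ 5 * (aeval ζ (derivative (cyclotomic 28 ℚ)))⁻¹)) * (1 + 2 * (ζ ^ 4 + ζ ^ 8 + ζ ^ 16)) * (ζ + ζ⁻¹) ^ 5) = -42 := by
  have h28 : ζ ^ 28 = 1 := hζ.pow_eq_one
  have hΦ := cyc_twentyEight hζ
  rw [trace_of_key hζ (C (0 : ℚ) + C (21 : ℚ) * X + C (0 : ℚ) * X ^ 2 + C (-35 : ℚ) * X ^ 3 + C (0 : ℚ) * X ^ 4 +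
      C (21 : ℚ) * X ^ 5 + C (0 : ℚ) * X ^ 6 + C (-7 : ℚ) * X ^ 7 + C (0 : ℚ) * X ^ 8 + C (21 : ℚ) * X ^ 9 +
      C (0 : ℚ) * X ^ 10 + C (-42 : ℚ) * X ^ 11) (by compute_degree) (by
    simp only [map_add, map_mul, map_pow, aeval_C, aeval_X, eq_ratCast]
    push_cast
    linear_combination ((aeval ζ (derivative (cyclotomic 28 ℚ)))⁻¹ * (-8 + ζ^2 + 21 * ζ^4 - ζ^6 + 26 * ζ^8 + 18 * ζ^10 - 18 * ζ^12 - 18 * ζ^14)) * hΦ +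
      ((aeval ζ (derivative (cyclotomic 28 ℚ)))⁻¹ * (-8 + 9 * ζ^2 + 12 * ζ^4 + 8 * ζ^6 + 4 * ζ^8 - 4 * ζ^12 - 8 * ζ^14 -
        12 * ζ^16 - 9 * ζ^18 + 8 * ζ^20 + 18 * ζ^22 - 18 * ζ^26 - 8 * ζ^28 +
        8 * ζ^30 + 8 * ζ^32 + 2 * ζ^34)) * h28)]
  norm_num [coeff_X_pow, coeff_X, coeff_C, coeff_one]

/-- `Tr(ζ′sθ^6) = 0` for `ζ′ = π₇ξ, π₇ = ζ²⁵(1 − ζ⁴)(1 − ζ²)`, `s = √−7 = 1 + 2(ζ⁴ + ζ⁸ + ζ¹⁶)`, `θ = ζ + ζ⁻¹` (Euler evaluation). research route conditional on HC_CM; not a corollary; Q11.4-sentence-2 already refuted in dim ≥ 3. [folklore] -/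
theorem trace_piSeven_sqrtNegSeven_six [IsCyclotomicExtension {28} ℚ K] (hζ : IsPrimitiveRoot ζ 28) :
    Algebra.trace ℚ K ((ζ ^ 25 * (1 - ζ ^ 4) * (1 - ζ ^ 2) * (ζ ^ 5 * (aeval ζ (derivative (cyclotomic 28 ℚ)))⁻¹)) * (1 + 2 * (ζ ^ 4 + ζ ^ 8 + ζ ^ 16)) * (ζ + ζ⁻¹) ^ 6) = 0 := by
  have h28 : ζ ^ 28 = 1 := hζ.pow_eq_one
  have hΦ := cyc_twentyEight hζ
  rw [trace_of_key hζ (C (63 : ℚ) + C (0 : ℚ) * X + C (-56 : ℚ) * X ^ 2 + C (0 : ℚ) * X ^ 3 + C (28 : ℚ) * X ^ 4 +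
      C (0 : ℚ) * X ^ 5 + C (-28 : ℚ) * X ^ 6 + C (0 : ℚ) * X ^ 7 + C (56 : ℚ) * X ^ 8 + C (0 : ℚ) * X ^ 9 +
      C (-63 : ℚ) * X ^ 10 + C (0 : ℚ) * X ^ 11) (by compute_degree) (by
    simp only [map_add, map_mul, map_pow, aeval_C, aeval_X, eq_ratCast]
    push_cast
    linear_combination ((aeval ζ (derivative (cyclotomic 28 ℚ)))⁻¹ * (-26 - 25 * ζ^2 + 22 * ζ^4 - 22 * ζ^6 + 25 * ζ^8 + 44 * ζ^10 - 18 * ζ^14)) * hΦ +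
      ((aeval ζ (derivative (cyclotomic 28 ℚ)))⁻¹ * (-26 + ζ^2 + 21 * ζ^4 + 20 * ζ^6 + 12 * ζ^8 + 4 * ζ^10 - 4 * ζ^12 -
        12 * ζ^14 - 20 * ζ^16 - 21 * ζ^18 - ζ^20 + 26 * ζ^22 + 18 * ζ^24 -
        18 * ζ^26 - 26 * ζ^28 + 16 * ζ^32 + 10 * ζ^34 + 2 * ζ^36)) * h28)]
  norm_num [coeff_X_pow, coeff_X, coeff_C, coeff_one]

/-- `Tr(ζ′sθ^7) = -126` for `ζ′ = π₇ξ, π₇ = ζ²⁵(1 − ζ⁴)(1 − ζ²)`, `s = √−7 = 1 + 2(ζ⁴ + ζ⁸ + ζ¹⁶)`, `θ = ζ + ζ⁻¹` (Euler evaluation). research route conditional on HC_CM; not a corollary; Q11.4-sentence-2 already refuted in dim ≥ 3. [folklore] -/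
theorem trace_piSeven_sqrtNegSeven_seven [IsCyclotomicExtension {28} ℚ K] (hζ : IsPrimitiveRoot ζ 28) :
    Algebra.trace ℚ K ((ζ ^ 25 * (1 - ζ ^ 4) * (1 - ζ ^ 2) * (ζ ^ 5 * (aeval ζ (derivative (cyclotomic 28 ℚ)))⁻¹)) * (1 + 2 * (ζ ^ 4 + ζ ^ 8 + ζ ^ 16)) * (ζ + ζ⁻¹) ^ 7) = -126 := by
  have h28 : ζ ^ 28 = 1 := hζ.pow_eq_one
  have hΦ := cyc_twentyEight hζ
  rw [trace_of_key hζ (C (0 : ℚ) + C (70 : ℚ) * X + C (0 : ℚ) * X ^ 2 + C (-91 : ℚ) * X ^ 3 + C (0 : ℚ) * X ^ 4 +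
      C (63 : ℚ) * X ^ 5 + C (0 : ℚ) * X ^ 6 + C (-35 : ℚ) * X ^ 7 + C (0 : ℚ) * X ^ 8 + C (56 : ℚ) * X ^ 9 +
      C (0 : ℚ) * X ^ 10 + C (-126 : ℚ) * X ^ 11) (by compute_degree) (by
    simp only [map_add, map_mul, map_pow, aeval_C, aeval_X, eq_ratCast]
    push_cast
    linear_combination ((aeval ζ (derivative (cyclotomic 28 ℚ)))⁻¹ * (-44 - 69 * ζ^2 - 3 * ζ^4 + 63 * ζ^6 + 3 * ζ^8 + 69 * ζ^10 + 44 * ζ^12)) * hΦ +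
      ((aeval ζ (derivative (cyclotomic 28 ℚ)))⁻¹ * (-44 - 25 * ζ^2 + 22 * ζ^4 + 41 * ζ^6 + 32 * ζ^8 + 16 * ζ^10 - 16 * ζ^14 -
        32 * ζ^16 - 41 * ζ^18 - 22 * ζ^20 + 25 * ζ^22 + 44 * ζ^24 - 44 * ζ^28 -
        26 * ζ^30 + 16 * ζ^32 + 26 * ζ^34 + 12 * ζ^36 + 2 * ζ^38)) * h28)]
  norm_num [coeff_X_pow, coeff_X, coeff_C, coeff_one]

/-- `Tr(ζ′sθ^8) = 0` for `ζ′ = π₇ξ, π₇ = ζ²⁵(1 − ζ⁴)(1 − ζ²)`, `s = √−7 = 1 + 2(ζ⁴ + ζ⁸ + ζ¹⁶)`, `θ = ζ + ζ⁻¹` (Euler evaluation). research route conditional on HC_CM; not a corollary; Q11.4-sentence-2 already refuted in dim ≥ 3. [folklore] -/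
theorem trace_piSeven_sqrtNegSeven_eight [IsCyclotomicExtension {28} ℚ K] (hζ : IsPrimitiveRoot ζ 28) :
    Algebra.trace ℚ K ((ζ ^ 25 * (1 - ζ ^ 4) * (1 - ζ ^ 2) * (ζ ^ 5 * (aeval ζ (derivative (cyclotomic 28 ℚ)))⁻¹)) * (1 + 2 * (ζ ^ 4 + ζ ^ 8 + ζ ^ 16)) * (ζ + ζ⁻¹) ^ 8) = 0 := by
  have h28 : ζ ^ 28 = 1 := hζ.pow_eq_one
  have hΦ := cyc_twentyEight hζ
  rw [trace_of_key hζ (C (196 : ℚ) + C (0 : ℚ) * X + C (-147 : ℚ) * X ^ 2 + C (0 : ℚ) * X ^ 3 + C (98 : ℚ) * X ^ 4 +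
      C (0 : ℚ) * X ^ 5 + C (-98 : ℚ) * X ^ 6 + C (0 : ℚ) * X ^ 7 + C (147 : ℚ) * X ^ 8 + C (0 : ℚ) * X ^ 9 +
      C (-196 : ℚ) * X ^ 10 + C (0 : ℚ) * X ^ 11) (by compute_degree) (by
    simp only [map_add, map_mul, map_pow, aeval_C, aeval_X, eq_ratCast]
    push_cast
    linear_combination ((aeval ζ (derivative (cyclotomic 28 ℚ)))⁻¹ * (-44 - 113 * ζ^2 - 72 * ζ^4 + 60 * ζ^6 - 60 * ζ^8 + 72 * ζ^10 +
        113 * ζ^12 + 44 * ζ^14)) * hΦ +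
      ((aeval ζ (derivative (cyclotomic 28 ℚ)))⁻¹ * (-44 - 69 * ζ^2 - 3 * ζ^4 + 63 * ζ^6 + 73 * ζ^8 + 48 * ζ^10 + 16 * ζ^12 -
        16 * ζ^14 - 48 * ζ^16 - 73 * ζ^18 - 63 * ζ^20 + 3 * ζ^22 + 69 * ζ^24 +
        44 * ζ^26 - 44 * ζ^28 - 70 * ζ^30 - 10 * ζ^32 + 42 * ζ^34 + 38 * ζ^36 +
        14 * ζ^38 + 2 * ζ^40)) * h28)]
  norm_num [coeff_X_pow, coeff_X, coeff_C, coeff_one]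

/-- `Tr(ζ′sθ^9) = -392` for `ζ′ = π₇ξ, π₇ = ζ²⁵(1 − ζ⁴)(1 − ζ²)`, `s = √−7 = 1 + 2(ζ⁴ + ζ⁸ + ζ¹⁶)`, `θ = ζ + ζ⁻¹` (Euler evaluation). research route conditional on HC_CM; not a corollary; Q11.4-sentence-2 already refuted in dim ≥ 3. [folklore] -/
theorem trace_piSeven_sqrtNegSeven_nine [IsCyclotomicExtension {28} ℚ K] (hζ : IsPrimitiveRoot ζ 28) :
    Algebra.trace ℚ K ((ζ ^ 25 * (1 - ζ ^ 4) * (1 - ζ ^ 2) * (ζ ^ 5 * (aeval ζ (derivative (cyclotomic 28 ℚ)))⁻¹)) * (1 + 2 * (ζ ^ 4 + ζ ^ 8 + ζ ^ 16)) * (ζ + ζ⁻¹) ^ 9) = -392 := by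
  have h28 : ζ ^ 28 = 1 := hζ.pow_eq_one
  have hΦ := cyc_twentyEight hζ
  rw [trace_of_key hζ (C (0 : ℚ) + C (245 : ℚ) * X + C (0 : ℚ) * X ^ 2 + C (-245 : ℚ) * X ^ 3 + C (0 : ℚ) * X ^ 4 +
      C (196 : ℚ) * X ^ 5 + C (0 : ℚ) * X ^ 6 + C (-147 : ℚ) * X ^ 7 + C (0 : ℚ) * X ^ 8 + C (147 : ℚ) * X ^ 9 +
      C (0 : ℚ) * X ^ 10 + C (-392 : ℚ) * X ^ 11) (by compute_degree) (by
    simp only [map_add, map_mul, map_pow, aeval_C, aeval_X, eq_ratCast]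
    push_cast
    linear_combination ((aeval ζ (derivative (cyclotomic 28 ℚ)))⁻¹ * (-113 * ζ^2 - 185 * ζ^4 - 12 * ζ^6 + 196 * ζ^8 + 12 * ζ^10 + 185 * ζ^12 +
        113 * ζ^14)) * hΦ +
      ((aeval ζ (derivative (cyclotomic 28 ℚ)))⁻¹ * (-113 * ζ^2 - 72 * ζ^4 + 60 * ζ^6 + 136 * ζ^8 + 121 * ζ^10 + 64 * ζ^12 -
        64 * ζ^16 - 121 * ζ^18 - 136 * ζ^20 - 60 * ζ^22 + 72 * ζ^24 + 113 * ζ^26 -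
        114 * ζ^30 - 80 * ζ^32 + 32 * ζ^34 + 80 * ζ^36 + 52 * ζ^38 + 16 * ζ^40 +
        2 * ζ^42)) * h28)]
  norm_num [coeff_X_pow, coeff_X, coeff_C, coeff_one]

/-- `Tr(ζ′sθ^10) = 0` for `ζ′ = π₇ξ, π₇ = ζ²⁵(1 − ζ⁴)(1 − ζ²)`, `s = √−7 = 1 + 2(ζ⁴ + ζ⁸ + ζ¹⁶)`, `θ = ζ + ζ⁻¹` (Euler evaluation). research route conditional on HC_CM; not a corollary; Q11.4-sentence-2 already refuted in dim ≥ 3. [folklore] -/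
theorem trace_piSeven_sqrtNegSeven_ten [IsCyclotomicExtension {28} ℚ K] (hζ : IsPrimitiveRoot ζ 28) :
    Algebra.trace ℚ K ((ζ ^ 25 * (1 - ζ ^ 4) * (1 - ζ ^ 2) * (ζ ^ 5 * (aeval ζ (derivative (cyclotomic 28 ℚ)))⁻¹)) * (1 + 2 * (ζ ^ 4 + ζ ^ 8 + ζ ^ 16)) * (ζ + ζ⁻¹) ^ 10) = 0 := by
  have h28 : ζ ^ 28 = 1 := hζ.pow_eq_one
  have hΦ := cyc_twentyEight hζ
  rw [trace_of_key hζ (C (637 : ℚ) + C (0 : ℚ) * X + C (-392 : ℚ) * X ^ 2 + C (0 : ℚ) * X ^ 3 + C (343 : ℚ) * X ^ 4 +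
      C (0 : ℚ) * X ^ 5 + C (-343 : ℚ) * X ^ 6 + C (0 : ℚ) * X ^ 7 + C (392 : ℚ) * X ^ 8 + C (0 : ℚ) * X ^ 9 +
      C (-637 : ℚ) * X ^ 10 + C (0 : ℚ) * X ^ 11) (by compute_degree) (by
    simp only [map_add, map_mul, map_pow, aeval_C, aeval_X, eq_ratCast]
    push_cast
    linear_combination ((aeval ζ (derivative (cyclotomic 28 ℚ)))⁻¹ * (113 - 298 * ζ^4 - 197 * ζ^6 + 184 * ζ^8 - 184 * ζ^10 + 197 * ζ^12 +
        185 * ζ^14)) * hΦ +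
      ((aeval ζ (derivative (cyclotomic 28 ℚ)))⁻¹ * (113 - 113 * ζ^2 - 185 * ζ^4 - 12 * ζ^6 + 196 * ζ^8 + 257 * ζ^10 +
        185 * ζ^12 + 64 * ζ^14 - 64 * ζ^16 - 185 * ζ^18 - 257 * ζ^20 -
        196 * ζ^22 + 12 * ζ^24 + 185 * ζ^26 + 113 * ζ^28 - 114 * ζ^30 -
        194 * ζ^32 - 48 * ζ^34 + 112 * ζ^36 + 132 * ζ^38 + 68 * ζ^40 + 18 * ζ^42 +
        2 * ζ^44)) * h28)]
  norm_num [coeff_X_pow, coeff_X, coeff_C, coeff_one]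

/-- **The Gram datum `a` of `(E_ζ′, s)` in the real frame `θ^i` (`i < 6`)** for `ζ′ = π₇ξ, π₇ = ζ²⁵(1 − ζ⁴)(1 − ζ²)` (type 𝔮₇: `𝔬𝔣₀ = (π₇)`, `(𝔬𝔣₀)⁶ = (7)`, degree 7),
`s = √−7 = 1 + 2(ζ⁴ + ζ⁸ + ζ¹⁶)`: the integer Hankel matrix `(−Tr(ζ′sθ^{i+j}))ᵢⱼ` (and `b = 0`, part 82 `hb_eq_zero`).
research route conditional on HC_CM; not a corollary; Q11.4-sentence-2 already refuted in dim ≥ 3. [cite: vanGeemen1994HodgeAV, Lemma 5.2 (2)–(3)] -/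
theorem realPart_piSeven_sqrtNegSeven [IsCyclotomicExtension {28} ℚ K] [IsCMField K] (hζ : IsPrimitiveRoot ζ 28)
    {x : Fin 6 → K} (hx : ∀ i, x i = (ζ + ζ⁻¹) ^ (i : ℕ)) {a : Matrix (Fin 6) (Fin 6) ℚ}
    (ha : ∀ i j, a i j = Algebra.trace ℚ K ((ζ ^ 25 * (1 - ζ ^ 4) * (1 - ζ ^ 2) * (ζ ^ 5 * (aeval ζ (derivative (cyclotomic 28 ℚ)))⁻¹)) * x i * IsCMField.complexConj K ((1 + 2 * (ζ ^ 4 + ζ ^ 8 + ζ ^ 16)) * x j))) :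
    a = !![0, 4, 0, 14, 0, 42; 4, 0, 14, 0, 42, 0; 0, 14, 0, 42, 0, 126; 14, 0, 42, 0, 126, 0; 0, 42, 0, 126, 0, 392; 42, 0, 126, 0, 392, 0] := by
  rw [ha_eq (complexConj_sqrtNegSeven hζ) (complexConj_thetaFrame hζ hx) ha]
  ext i j
  simp only [Matrix.of_apply, hx, ← pow_add]
  fin_cases i <;> fin_cases j <;> simp [trace_piSeven_sqrtNegSeven_zero hζ, trace_piSeven_sqrtNegSeven_one hζ, trace_piSeven_sqrtNegSeven_two hζ, trace_piSeven_sqrtNegSeven_three hζ, trace_piSeven_sqrtNegSeven_four hζ, trace_piSeven_sqrtNegSeven_five hζ,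
    trace_piSeven_sqrtNegSeven_six hζ, trace_piSeven_sqrtNegSeven_seven hζ, trace_piSeven_sqrtNegSeven_eight hζ, trace_piSeven_sqrtNegSeven_nine hζ, trace_piSeven_sqrtNegSeven_ten hζ]

/-- **`det a = -153664`** for `ζ′ = π₇ξ, π₇ = ζ²⁵(1 − ζ⁴)(1 − ζ²)`, `s = √−7 = 1 + 2(ζ⁴ + ζ⁸ + ζ¹⁶)` (frame `θ^i`, `i < 6`). research route conditional on HC_CM; not a corollary; Q11.4-sentence-2 already refuted in dim ≥ 3. [cite: vanGeemen1994HodgeAV, Lemma 5.2 (3)] -/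
theorem det_realPart_piSeven_sqrtNegSeven [IsCyclotomicExtension {28} ℚ K] [IsCMField K] (hζ : IsPrimitiveRoot ζ 28)
    {x : Fin 6 → K} (hx : ∀ i, x i = (ζ + ζ⁻¹) ^ (i : ℕ)) {a : Matrix (Fin 6) (Fin 6) ℚ}
    (ha : ∀ i j, a i j = Algebra.trace ℚ K ((ζ ^ 25 * (1 - ζ ^ 4) * (1 - ζ ^ 2) * (ζ ^ 5 * (aeval ζ (derivative (cyclotomic 28 ℚ)))⁻¹)) * x i * IsCMField.complexConj K ((1 + 2 * (ζ ^ 4 + ζ ^ 8 + ζ ^ 16)) * x j))) :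
    a.det = -153664 := by
  rw [realPart_piSeven_sqrtNegSeven hζ hx ha]
  simp [Matrix.det_succ_row_zero, Fin.sum_univ_succ, Fin.succAbove, Matrix.submatrix]
  norm_num

/-! ### §2 Invariance, census form, class: SPLIT -/

/-- **For EVERY skew `ζ′` of type 𝔮₇ (degree `7`) on `ℤ[ζ_28]` (`IsOfType 1 ζ′ 𝔣₀`, `𝔬𝔣₀ = (π)`, `(𝔬𝔣₀)⁶ = (7)`, degree `7`; `ζ′ = u·πξ`,
`u` a real unit of norm `1` by THEOREM L (i) at `28`) the Gram determinant of `(E_ζ′, s₇)` in the frame `θ^i` is `-153664`**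
(they exist on every `ℚ(√−7)`-balanced `Φ`, part 49a): the SPLIT row R0 for `ℚ(√−7)` (census W6.7.1 `= (3, ℚ(√−7), 1)`).
research route conditional on HC_CM; not a corollary; Q11.4-sentence-2 already refuted in dim ≥ 3. [cite: vanGeemen1994HodgeAV, Lemma 5.2 (3)–(4) and (5.4.1)] [cite: Shimura1998, §14.3 Prop. 4–5, pp. 103–104] -/
theorem det_realPart_typeSeven_sqrtNegSeven [IsCyclotomicExtension {28} ℚ K] [IsCMField K]
    (hζ : IsPrimitiveRoot ζ 28) {𝔣₀ : Ideal (𝓞 (maximalRealSubfield K))}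
    (h𝔣₀ : 𝔣₀.map (algebraMap (𝓞 (maximalRealSubfield K)) (𝓞 K)) = Ideal.span {hζ.toInteger ^ 25 * (1 - hζ.toInteger ^ 4) * (1 - hζ.toInteger ^ 2)})
    {ζ' : K} (hζ' : IsCMField.complexConj K ζ' = -ζ')
    (hT : CMTypeLattice.IsOfType (1 : (FractionalIdeal (𝓞 K)⁰ K)ˣ) ζ' 𝔣₀)
    {x : Fin 6 → K} (hx : ∀ i, x i = (ζ + ζ⁻¹) ^ (i : ℕ)) {a : Matrix (Fin 6) (Fin 6) ℚ}
    (ha : ∀ i j, a i j = Algebra.trace ℚ K (ζ' * x i * IsCMField.complexConj K ((1 + 2 * (ζ ^ 4 + ζ ^ 8 + ζ ^ 16)) * x j))) :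
    a.det = -153664 := by
  obtain ⟨ωb, hωb⟩ := exists_basis_thetaPow hζ
  have hx' : ∀ i, x i = (ωb i : K) := fun i => (hx i).trans (hωb i).symm
  have hg : Nat.totient 28 = 2 * (5 + 1) := by decide
  have hsk : IsCMField.complexConj K (ζ ^ 25 * (1 - ζ ^ 4) * (1 - ζ ^ 2) * (ζ ^ 5 * (aeval ζ (derivative (cyclotomic 28 ℚ)))⁻¹)) =
      -(ζ ^ 25 * (1 - ζ ^ 4) * (1 - ζ ^ 2) * (ζ ^ 5 * (aeval ζ (derivative (cyclotomic 28 ℚ)))⁻¹)) := by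
    exact complexConj_gen_mul_xi hζ hg adm_twentyEight
  have h0 : (ζ ^ 25 * (1 - ζ ^ 4) * (1 - ζ ^ 2) * (ζ ^ 5 * (aeval ζ (derivative (cyclotomic 28 ℚ)))⁻¹)) ≠ 0 :=
    mul_ne_zero (by exact gen_ne_zero hζ adm_twentyEight) (xi_ne_zero hζ 5)
  have hT₀ : CMTypeLattice.IsOfType (1 : (FractionalIdeal (𝓞 K)⁰ K)ˣ) (ζ ^ 25 * (1 - ζ ^ 4) * (1 - ζ ^ 2) * (ζ ^ 5 * (aeval ζ (derivative (cyclotomic 28 ℚ)))⁻¹)) 𝔣₀ := by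
    exact isOfType_one_gen_mul_xi hζ 5 ((4, 2, 25) : ℕ × ℕ × ℕ) h𝔣₀
  rw [det_realPart_eq_of_isOfType ωb (complexConj_sqrtNegSeven hζ) hx' (norm_realUnits_pos_twentyEight hζ)
    hsk h0 hζ' hT₀ hT (fun i j => rfl) ha]
  exact det_realPart_piSeven_sqrtNegSeven hζ hx (fun i j => rfl)

open scoped Classical in
/-- **CENSUS FORM** (part 49a's existence + the determinant): for every CM type `Φ` of `ℚ(ζ_28)` balanced for `N_K = {3, 5, 13, 17, 19, 27}` (Weil signature `(3,3)`
for `K_d = ℚ(√−7)`) and the type `𝔣₀` above, `ℂ^Φ/Φ(ℤ[ζ_28])` carries a `Φ`-positive divisor of type `(K; Φ; 𝔣₀)`, and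
EVERY such divisor `X_ζ′` has van Geemen Gram determinant `-153664` in the real frame `θ^i`: the SPLIT row R0 for `ℚ(√−7)` (census W6.7.1 `= (3, ℚ(√−7), 1)`).
research route conditional on HC_CM; not a corollary; Q11.4-sentence-2 already refuted in dim ≥ 3. [cite: vanGeemen1994HodgeAV, Lemma 5.2 (3)–(4) and (5.4.1)] [cite: Shimura1998, §14.3 Prop. 4–5, pp. 103–104] -/
theorem exists_typeSeven_sqrtNegSeven_det [IsCyclotomicExtension {28} ℚ K] [IsCMField K]
    (hζ : IsPrimitiveRoot ζ 28) (Φ : CMType K)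
    (hbal : 2 * (SΦ[Φ, ζ] ∩ ({3, 5, 13, 17, 19, 27} : Finset (ZMod 28))).card = (SΦ[Φ, ζ]).card)
    {𝔣₀ : Ideal (𝓞 (maximalRealSubfield K))}
    (h𝔣₀ : 𝔣₀.map (algebraMap (𝓞 (maximalRealSubfield K)) (𝓞 K)) =
      Ideal.span {hζ.toInteger ^ 25 * (1 - hζ.toInteger ^ 4) * (1 - hζ.toInteger ^ 2)}) :
    ∃ ζ' : K, IsCMField.complexConj K ζ' = -ζ' ∧ (∀ φ : Φ.1, 0 < (φ.1 ζ').im) ∧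
      CMTypeLattice.IsOfType (1 : (FractionalIdeal (𝓞 K)⁰ K)ˣ) ζ' 𝔣₀ ∧
      ∀ (x : Fin 6 → K), (∀ i, x i = (ζ + ζ⁻¹) ^ (i : ℕ)) → ∀ a : Matrix (Fin 6) (Fin 6) ℚ,
        (∀ i j, a i j = Algebra.trace ℚ K (ζ' * x i * IsCMField.complexConj K ((1 + 2 * (ζ ^ 4 + ζ ^ 8 + ζ ^ 16)) * x j))) →
        a.det = -153664 := by
  obtain ⟨ζ', h1, h2, h3⟩ := exists_type_twentyEight_sqrt_neg_seven hζ Φ hbal h𝔣₀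
  exact ⟨ζ', h1, h2, h3, fun x hx a ha => det_realPart_typeSeven_sqrtNegSeven hζ h𝔣₀ h1 h3 hx ha⟩

/-- **`[-153664] = [−1]·[153664]` is the SPLIT class `splitDiscriminantClass 3 7` in `ℚˣ/Nm(ℚ(√−7)ˣ)`** (`153664 = 392² + 7·0² ∈ Nm`):
the type-`𝔮₇` (degree `7`) polarised Weil-type `ℤ[ζ₂₈]`-CM sixfolds lie on the SPLIT row R0 for `ℚ(√−7)` (census W6.7.1 `= (3, ℚ(√−7), 1)`).
research route conditional on HC_CM; not a corollary; Q11.4-sentence-2 already refuted in dim ≥ 3. [cite: vanGeemen1994HodgeAV, 5.4 and (5.4.1)] -/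
theorem mk0_det_typeSeven_sqrtNegSeven :
    (QuotientGroup.mk (Units.mk0 (-153664 : ℚ) (by norm_num)) : weilNormResidueGroup 7) = splitDiscriminantClass 3 7 :=
  mk_neg_eq_split_of_odd (by decide) (by norm_num : (153664 : ℚ) ≠ 0)
    (mem_normUnitsSubgroup_of_sq_add_mul_sq _ (392 : ℚ) (0 : ℚ) (by norm_num))

end Summit.HodgeConjecture.Ring2WeilCoverage.WeilGramLevel28TypeSeven

end
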